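import Summits.Langlands.Langlands.Theses.FifteenLocusEisenstein
import Summits.Langlands.Langlands.Theses.SkinnerWilesDefectOne
import Summits.Langlands.Langlands.Theorems.SkinnerWilesDefectOneFiveIsogenyEllipticCurvesSatake
import Literature.NumberTheory.Automorphic.CompletedCohomologyHeckeAlgebraGLn
import Literature.NumberTheory.GaloisRepresentations.OrdinaryGaloisRep
import Literature.FieldTheory.AlgClosed.PadicAlgClEquivComplex
import HarnessLib

/-!
# BIRTH SKELETON (BC3) — crux stmt-Langlands-16055 `FifteenLocusEisenstein.UnorientedOrdinaryModular`
(route `route-Langlands-FifteenLocusEisenstein`, rank 3), line `birth`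

Registered by `planner-skel-stmt-Langlands-16055-0` (skeleton registrar, 2026-08-17).

## The crux (fixed; decl and signature are the route's)

`F` imaginary quadratic, `p` odd, `E` an integral Weierstrass model over `𝓞_F` with `Δ ≠ 0`, no
geometric CM, `E[p]` reducible; (hA) some IRREDUCIBLE TATE FRAME `ρ : Γ_F → GL₂(ℚ̄_p)` of `E` at `p`
(irreducible, a.e. unramified, Frobenius characteristic polynomial `X² − a_w(E) X + N w` a.e.) is
nearly ordinary of weight 2 at every `v ∣ p`; (hB) `E` admits NO Skinner–Wiles datum (no irreducible
Tate frame with a residually upper-triangular integral model over the valuation ring of `ℚ̄_p` that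
is `p`-distinguished and ORIENTED ordinary of weight 2 at every `v ∣ p`) ⟹ `E` is modular in
point-count form (for every level witness `hcpt` an L-algebraic cuspidal `π` on `GL₂(𝔸_F)` with
`Σ α⁻¹ = a_w(E)`, `Π α⁻¹ = N w` at almost every `w`).  The route's `closes` consumes it at `p = 5`.

## The cut = the parent route's ENGINE / EXIT architecture, run in the unoriented sector

Route `SkinnerWilesDefectOne` (the imported engine of this route) decides its target as
`ReducibleOrdinaryProModular → ProModularOrdinaryClassical → ReducibleOrdinaryModular`
(pro-modularity, then classicality of ordinary pro-modular points; banked glue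
`ModularOfProModularClassical`).  Its exit `ProModularOrdinaryClassical` (stmt-Langlands-12921) is
typed WITHOUT residual or orientation hypotheses precisely so that other `GL₂/F` routes dedup with
it; this skeleton uses it BY NAME and cuts the remaining (pro-modularity) content of the crux along
the one structural dichotomy the crux's own text names — `p`-DISTINGUISHED versus NOT:

* `stub_integralTateFrame` (PROVABLE, size L — Galois-side bookkeeping the tree does not yet have,
  cf. the module docstring of `OrdinaryGaloisRep`: "Not here: the existence of a residually
  upper-triangular integral model"): from (hA) and `E[p]` reducible, SOME irreducible Tate frame `ρ`
  of `E` at `p` (a `GL₂(ℚ̄_p)`-conjugate of the given one: Ribet lattice adapted to a `Γ_F`-stable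
  residual line, which exists because `ρ̄^ss ≅ (E[p] ⊗ 𝔽̄_p)^ss` is a sum of two characters —
  Chebotarev + Brauer–Nesbitt on the a.e. charpoly clause + Hasse–Weil mod `p`) carries a residually
  upper-triangular integral model `ρ₀` over the valuation ring `O` of `ℚ̄_p`
  (`HasUpperTriangularIntegralModel`), and is nearly ordinary of weight 2 at every `v ∣ p` with ONE
  COMMON inertial exponent `m > 0` (finitely many `v ∣ p`, `IsOrdinaryOfWeightAt.of_dvd`,
  frame-invariance `isOrdinaryOfWeightAt_conj_iff`).
* `stub_mixedProModular` (OPEN — THE HEART; the route's "mixed type"): given such a datum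
  `(O, ρ, ρ₀, m)` that is `p`-DISTINGUISHED at every `v ∣ p`, and (hB), `ρ` is `p`-ADICALLY
  AUTOMORPHIC of some tame level (`∃ 𝒰 : TameLevel 2 F p, 𝒰.IsPadicallyAutomorphic ρ`, verbatim the
  conclusion of the parent's engine `ReducibleOrdinaryProModular`).  Content: distinguished at every
  `v ∣ p` + no oriented model forces `p` SPLIT in `F` with the isogeny kernel of multiplicative type
  at `v₁` and étale at `v₂` for every lattice (one place ⇒ the lattice whose residual sub-character
  is the local unramified quotient character is oriented), i.e. exactly the population
  Skinner–Wiles exclude; intended mechanism (route header): Skinner–Wiles propagation (I)–(III) in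
  the mixed-oriented nearly-ordinary deformation ring over `Λ_F`, seeded by the CM-type Eisenstein
  pencil `ψ ⊕ εψ_det ψ⁻¹`, `ψ` of infinity type `(1,0)` (Hodge–Tate `1` at `v₁`, `0` at `v₂`), which
  is its reducible locus and still has parallel weight `(0,1)`; Calegari–Geraghty complexes at
  defect `l₀ = 1`.  Why it might fail: the mixed reducible pencil has dimension `h¹_f` of an
  anticyclotomic CM character (may exceed 1); nearly-ordinary automorphy of CM-type Eisenstein
  systems with the MIXED refinement in the Bianchi Hida / completed Hecke algebra is unrecorded.
* `stub_nonDistinguishedProModular` (OPEN, a DIFFERENT piece): given a datum that is NOT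
  `p`-distinguished at some `v ∣ p` (the two residual characters agree on `D_v`; intrinsic to `E`,
  so no Skinner–Wiles datum can exist), `ρ` is `p`-adically automorphic of some tame level.  At
  `p ≥ 5` this is expected vacuous for curves (`e(F_v/ℚ_p) ≤ 2 < p − 1`, route header), so the
  piece the route actually consumes (`p = 5`) is `stub_mixedProModular`; at `p = 3` (`ζ₃ ∈ F_v`,
  rational 3-torsion) it is inhabited and its natural mechanism is Pan-type (patched completed
  homology + `p`-adic local Langlands for `GL₂(ℚ_p)`, available only at split `v`), NOT
  Skinner–Wiles — which is why it is cut out rather than hidden in the heart.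
* `stub_proModularOrdinaryClassical` — the parent's EXIT BY NAME
  (`SkinnerWilesDefectOne.ProModularOrdinaryClassical`, stmt-Langlands-12921, open, with its own
  registered lines under `Cruxes/ProModularOrdinaryClassical/Lines/`): an irreducible a.e.-unramified
  `p`-adically automorphic `ρ`, ordinary of one parallel weight `k ≥ 2` with one exponent `m` at
  every `v ∣ p`, is classically automorphic (L-algebraic cuspidal `π`, Satake–Frobenius compatible
  a.e.).

`UnorientedOrdinaryModular_of` (kernel-checked, no `sorry`; hypotheses = the four stub statements by
name via `_Goal.stub_x := type_of% @stub_x`): take the datum of stub 1; `by_cases` on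
`p`-distinguishedness at every `v ∣ p` — stub 2 or stub 3 gives a tame level with
`IsPadicallyAutomorphic ρ`; choose `ι : ℚ̄_p ≃+* ℂ` (`PadicAlgCl.nonempty_ringEquiv_complex`, proved);
the exit gives an L-algebraic cuspidal `π` with cofinite `SatakeFrobCompatibleAt ι π ρ`; the banked
rank-two Satake lemma `FiveIsogenyEllipticCurves.exists_hasSatakeParamAt_sum_prod_of_satakeFrobCompatibleAt`
(uniqueness of Frobenius charpolys + Vieta, the transport the proved `FiveIsogenyEllipticCurves`
used) turns it and the frame's charpoly clause into `Σ α⁻¹ = a_w(E)`, `Π α⁻¹ = N w` a.e.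
`unorientedOrdinaryModular_of_stubs : UnorientedOrdinaryModular` is the same composition with the
stubs plugged in by name.  `lean check`: sorries = the four stubs, nothing else.

Disproof used: none exists for this crux (`ledger crux ls stmt-Langlands-16055`: no workfiles at
registration; no `Theorems/UnorientedOrdinaryModular/Negative/`).  Honoured from the parent's
disprover files (read, not imported): `ReducibleOrdinaryProModular/Disproof.lean`
`withoutAEUnramified_false_of_witness` / `ae_isUnramifiedAt_of_isPadicallyAutomorphic` — any
pro-modularity claim must carry a.e.-unramifiedness of `ρ` (stubs 2–3 do, inside the Tate-frame
clause); `ProModularOrdinaryClassical/Disproof.lean` `crux_iff_perPlaceExponent` — the common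
exponent `m` asked of stub 1 is equivalent to per-place exponents (no strength lost).  Dead lines on
this crux: none recorded.  Crux evidence read: idea `al-trace-cosets-are-q-curves` (idea-node g7: the
`p = 5` slice on `X(b3,b5)` via ℚ-curves; census kit j019512: the unoriented class is inhabited over
30 fields `d ≤ 1200`, all with 5 split or ramified, none inert — consistent with the split-`p`
reading of stub 2).

References: C. Skinner, A. Wiles, Publ. Math. IHÉS 89 (1999) §1, §§4.1–4.6 [SkinnerWiles1999];
A. Caraiani, J. Newton, arXiv:2301.10509, Thm 1.1, 5.2, 7.1 [CaraianiNewton2023]; F. Calegari,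
D. Geraghty, Invent. Math. 211 (2018) [CalegariGeraghty2017]; J. Thorne, JEMS 2015 [Thorne2014];
T. Berger, K. Klosin, arXiv:1606.06535 and Compositio 2011 [BergerKlosin2011]; L. Pan, JAMS 35 (2022)
[Pan2022]; H. Hida, Duke 1993 / Ann. Inst. Fourier 1994 [Hida1993Duke, Hida1994AIF]; K. Buzzard,
T. Gee, LMS LNS 414 (2014) Conj. 3.2.1 [BuzzardGeeLMS2014]; J.-P. Serre, Abelian ℓ-adic
representations (1968) I.1.1, I.2.3 [SerreAbelianLadic1968].
-/

noncomputable section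

-- `Summit.Langlands.Langlands.…`: summit = sub-problem name (D-0017 nested layout), not a typo.
set_option linter.dupNamespace false

namespace Summit.Langlands.Langlands.Cruxes.UnorientedOrdinaryModular.Birth

open Summit.Langlands.Langlands.Theses.FifteenLocusEisenstein (UnorientedOrdinaryModular)

/-! ## 1. The four stubs (the ONLY sorries of this file) -/

/-- **STUB 1 — `integralTateFrame` (PROVABLE, size L).**  Under the crux hypotheses up to (hA): there
are the valuation ring `O` of `ℚ̄_p`, an irreducible Tate frame `ρ` of `E` at `p` (irreducible,
a.e. unramified with Frobenius characteristic polynomial `X² − a_w(E)X + N w`), a residually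
upper-triangular integral model `ρ₀ : Γ_F → GL₂(O)` of `ρ` IN THE SAME FRAME
(`HasUpperTriangularIntegralModel`), and ONE exponent `m > 0` with `ρ` ordinary of weight 2 and
exponent `m` at every `v ∣ p`.  Proof plan: re-frame the given frame on a Ribet lattice adapted to
a `Γ_F`-stable residual line (residual reducibility from `E[p]` reducible via Chebotarev +
Brauer–Nesbitt + Hasse–Weil mod `p`; compact image ⇒ model over a finite `L/ℚ_p`,
`exists_hasQlModel`/`exists_integralModel`), transport near-ordinarity by `isOrdinaryOfWeightAt_conj_iff`,
and take `m = ∏ m_v` over the finitely many `v ∣ p` (`IsOrdinaryOfWeightAt.of_dvd`).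
[cite: SerreAbelianLadic1968, Ch. I §1.1] [cite: SkinnerWiles1999, §4.6] -/
theorem stub_integralTateFrame :
    ∀ (F : Type) [Field F] [NumberField F], NumberField.IsTotallyComplex F → Module.finrank ℚ F = 2 → ∀ (p : ℕ) [Fact p.Prime], p ≠ 2 → ∀ (E : WeierstrassCurve (NumberField.RingOfIntegers F)), E.Δ ≠ 0 → ¬ (E.baseChange F).HasCM → ¬ (E.baseChange F).HasIrreducibleModPGaloisRep p → (∃ ρ : Literature.NumberTheory.GaloisRepresentations.FramedGaloisRep F (PadicAlgCl p) 2, (ρ.toGaloisRep.IsIrreducible ∧ ∀ᶠ w : IsDedekindDomain.HeightOneSpectrum (NumberField.RingOfIntegers F) in Filter.cofinite, ρ.IsUnramifiedAt w ∧ ρ.HasFrobCharpolyAt w (Polynomial.X ^ 2 - Polynomial.C ((Literature.NumberTheory.Automorphic.frobTraceAt E w : ℤ) : PadicAlgCl p) * Polynomial.X + Polynomial.C ((w.residueCard : ℕ) : PadicAlgCl p))) ∧ ∀ v : IsDedekindDomain.HeightOneSpectrum (NumberField.RingOfIntegers F), (p : NumberField.RingOfIntegers F) ∈ v.asIdeal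 → ∃ m : ℕ, 0 < m ∧ ρ.IsOrdinaryOfWeightAt p v 2 m) → ∃ (O : ValuationSubring (PadicAlgCl p)) (ρ : Literature.NumberTheory.GaloisRepresentations.FramedGaloisRep F (PadicAlgCl p) 2) (ρ₀ : Field.absoluteGaloisGroup F →* Matrix.GeneralLinearGroup (Fin 2) O), O = (Valued.v : Valuation (PadicAlgCl p) NNReal).valuationSubring ∧ (ρ.toGaloisRep.IsIrreducible ∧ ∀ᶠ w : IsDedekindDomain.HeightOneSpectrum (NumberField.RingOfIntegers F) in Filter.cofinite, ρ.IsUnramifiedAt w ∧ ρ.HasFrobCharpolyAt w (Polynomial.X ^ 2 - Polynomial.C ((Literature.NumberTheory.Automorphic.frobTraceAt E w : ℤ) : PadicAlgCl p) * Polynomial.X + Polynomial.C ((w.residueCard : ℕ) : PadicAlgCl p))) ∧ ρ.HasUpperTriangularIntegralModel ρ₀ ∧ ∃ m : ℕ, 0 < m ∧ ∀ v : IsDedekindDomain.HeightOneSpectrum (NumberField.RingOfIntegers F), (p : NumberField.RingOfIntegers F) ∈ v.asIdeal → ρ.IsOrdinaryOfWeightAt p v 2 m := by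
  sorry

/-- **STUB 2 — `mixedProModular` (OPEN; the heart of the crux).**  Under the crux hypotheses
including (hB) "no Skinner–Wiles datum": every integral Tate-frame datum `(O, ρ, ρ₀, m)` as in
stub 1 that is `p`-DISTINGUISHED at every `v ∣ p` has `ρ` `p`-adically automorphic of some tame
level `𝒰` of `GL₂/F` (`𝒰.IsPadicallyAutomorphic ρ`: `ρ` is associated with a continuous
`ℚ̄_p`-point of the completed-cohomology Hecke algebra `𝕋(𝒰)` of the Bianchi tower).  Distinguished
+ no oriented model = `p` split with swapped multiplicative/étale types of the isogeny kernel at the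
two places (the "mixed type" Skinner–Wiles exclude); intended mechanism: SW propagation in the
mixed-oriented nearly-ordinary deformation ring seeded by the CM-type Eisenstein pencil of infinity
type `(1,0)`.  Why it might fail: dimension of the mixed reducible pencil (`h¹_f` of an
anticyclotomic CM character) and the unrecorded nearly-ordinary automorphy of CM-type Eisenstein
systems with the mixed refinement.
[cite: SkinnerWiles1999, §§4.1–4.5] [cite: CalegariGeraghty2017] [cite: CaraianiNewton2023, Thm 5.2] -/
theorem stub_mixedProModular :
    ∀ (F : Type) [Field F] [NumberField F], NumberField.IsTotallyComplex F → Module.finrank ℚ F = 2 → ∀ (p : ℕ) [Fact p.Prime], p ≠ 2 → ∀ (E : WeierstrassCurve (NumberField.RingOfIntegers F)), E.Δ ≠ 0 → ¬ (E.baseChange F).HasCM → ¬ (E.baseChange F).HasIrreducibleModPGaloisRep p → ¬ (∃ (O : ValuationSubring (PadicAlgCl p)) (ρ : Literature.NumberTheory.GaloisRepresentations.FramedGaloisRep F (PadicAlgCl p) 2) (ρ₀ : Field.absoluteGaloisGroup F →* Matrix.GeneralLinearGroup (Fin 2) O), O = (Valued.v : Valuation (PadicAlgCl p) NNReal).valuationSubring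 ∧ (ρ.toGaloisRep.IsIrreducible ∧ ∀ᶠ w : IsDedekindDomain.HeightOneSpectrum (NumberField.RingOfIntegers F) in Filter.cofinite, ρ.IsUnramifiedAt w ∧ ρ.HasFrobCharpolyAt w (Polynomial.X ^ 2 - Polynomial.C ((Literature.NumberTheory.Automorphic.frobTraceAt E w : ℤ) : PadicAlgCl p) * Polynomial.X + Polynomial.C ((w.residueCard : ℕ) : PadicAlgCl p))) ∧ ρ.HasUpperTriangularIntegralModel ρ₀ ∧ ∃ m : ℕ, 0 < m ∧ ∀ v : IsDedekindDomain.HeightOneSpectrum (NumberField.RingOfIntegers F), (p : NumberField.RingOfIntegers F) ∈ v.asIdeal → Literature.NumberTheory.GaloisRepresentations.IsPDistinguishedAt ρ₀ v ∧ ∃ Q : Matrix.GeneralLinearGroup (Fin 2) (PadicAlgCl p), Valued.v (Q.val 0 0) ≤ Valued.v (Q.val 1 0) ∧ ∀ σ, (Q⁻¹ * ρ.toLocal v σ * Q).val 1 0 = 0 ∧ (σ ∈ Literature.NumberTheory.GaloisRepresentations.absInertia (v.adicCompletion F) → (Q⁻¹ * ρ.toLocal v σ * Q).val 1 1 ^ m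 = 1 ∧ (Q⁻¹ * ρ.toLocal v σ * Q).val 0 0 ^ m = algebraMap (Padic p) (PadicAlgCl p) (((Literature.NumberTheory.GaloisRepresentations.GaloisRep.cyclotomicCharacter (v.adicCompletion F) p σ).val : PadicInt p) : Padic p) ^ ((2 - 1) * m))) → ∀ (O : ValuationSubring (PadicAlgCl p)) (ρ : Literature.NumberTheory.GaloisRepresentations.FramedGaloisRep F (PadicAlgCl p) 2) (ρ₀ : Field.absoluteGaloisGroup F →* Matrix.GeneralLinearGroup (Fin 2) O), O = (Valued.v : Valuation (PadicAlgCl p) NNReal).valuationSubring → (ρ.toGaloisRep.IsIrreducible ∧ ∀ᶠ w : IsDedekindDomain.HeightOneSpectrum (NumberField.RingOfIntegers F) in Filter.cofinite, ρ.IsUnramifiedAt w ∧ ρ.HasFrobCharpolyAt w (Polynomial.X ^ 2 - Polynomial.C ((Literature.NumberTheory.Automorphic.frobTraceAt E w : ℤ) : PadicAlgCl p) * Polynomial.X + Polynomial.C ((w.residueCard : ℕ) : PadicAlgCl p))) → ρ.HasUpperTriangularIntegralModel ρ₀ → (∃ m : ℕ, 0 < m ∧ ∀ v : IsDedekindDomain.HeightOneSpectrum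 (NumberField.RingOfIntegers F), (p : NumberField.RingOfIntegers F) ∈ v.asIdeal → ρ.IsOrdinaryOfWeightAt p v 2 m) → (∀ v : IsDedekindDomain.HeightOneSpectrum (NumberField.RingOfIntegers F), (p : NumberField.RingOfIntegers F) ∈ v.asIdeal → Literature.NumberTheory.GaloisRepresentations.IsPDistinguishedAt ρ₀ v) → ∃ 𝒰 : Literature.NumberTheory.Automorphic.BigHeckeGLn.TameLevel 2 F p, 𝒰.IsPadicallyAutomorphic ρ := by
  sorry

/-- **STUB 3 — `nonDistinguishedProModular` (OPEN; the non-`p`-distinguished piece).**  Under the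
crux hypotheses up to `E[p]` reducible: every integral Tate-frame datum `(O, ρ, ρ₀, m)` as in stub 1
that is NOT `p`-distinguished at some `v ∣ p` (the two residual diagonal characters of `ρ₀` agree on
`Γ_{F_v}`) has `ρ` `p`-adically automorphic of some tame level.  No Skinner–Wiles datum can exist
here (distinguishedness is intrinsic to `ρ̄^ss`), so this is a genuine part of the crux; expected
vacuous at `p ≥ 5` for elliptic curves (`e(F_v/ℚ_p) ≤ 2 < p − 1`), inhabited at `p = 3`; natural
mechanism Pan-type (completed homology + `p`-adic local Langlands for `GL₂(ℚ_p)` at split `v`), not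
Skinner–Wiles.  Why it might fail (as a programme): no residually reducible NON-distinguished lifting
theorem is in print away from `F = ℚ`.
[cite: Pan2022] [cite: SkinnerWiles1999, §1 Theorem (i)] -/
theorem stub_nonDistinguishedProModular :
    ∀ (F : Type) [Field F] [NumberField F], NumberField.IsTotallyComplex F → Module.finrank ℚ F = 2 → ∀ (p : ℕ) [Fact p.Prime], p ≠ 2 → ∀ (E : WeierstrassCurve (NumberField.RingOfIntegers F)), E.Δ ≠ 0 → ¬ (E.baseChange F).HasCM → ¬ (E.baseChange F).HasIrreducibleModPGaloisRep p → ∀ (O : ValuationSubring (PadicAlgCl p)) (ρ : Literature.NumberTheory.GaloisRepresentations.FramedGaloisRep F (PadicAlgCl p) 2) (ρ₀ : Field.absoluteGaloisGroup F →* Matrix.GeneralLinearGroup (Fin 2) O), O = (Valued.v : Valuation (PadicAlgCl p) NNReal).valuationSubring → (ρ.toGaloisRep.IsIrreducible ∧ ∀ᶠ w : IsDedekindDomain.HeightOneSpectrum (NumberField.RingOfIntegers F) in Filter.cofinite, ρ.IsUnramifiedAt w ∧ ρ.HasFrobCharpolyAt w (Polynomial.X ^ 2 - Polynomial.C ((Literature.NumberTheory.Automorphic.frobTraceAt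 E w : ℤ) : PadicAlgCl p) * Polynomial.X + Polynomial.C ((w.residueCard : ℕ) : PadicAlgCl p))) → ρ.HasUpperTriangularIntegralModel ρ₀ → (∃ m : ℕ, 0 < m ∧ ∀ v : IsDedekindDomain.HeightOneSpectrum (NumberField.RingOfIntegers F), (p : NumberField.RingOfIntegers F) ∈ v.asIdeal → ρ.IsOrdinaryOfWeightAt p v 2 m) → (∃ v : IsDedekindDomain.HeightOneSpectrum (NumberField.RingOfIntegers F), (p : NumberField.RingOfIntegers F) ∈ v.asIdeal ∧ ¬ Literature.NumberTheory.GaloisRepresentations.IsPDistinguishedAt ρ₀ v) → ∃ 𝒰 : Literature.NumberTheory.Automorphic.BigHeckeGLn.TameLevel 2 F p, 𝒰.IsPadicallyAutomorphic ρ := by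
  sorry

/-- **STUB 4 — the EXIT, BY NAME** (`SkinnerWilesDefectOne.ProModularOrdinaryClassical`,
stmt-Langlands-12921, the parent route's rank-4 crux, shared): over an imaginary quadratic `F`,
`p` odd, every irreducible a.e.-unramified `ρ : Γ_F → GL₂(ℚ̄_p)` that is `p`-adically automorphic
of some tame level and ordinary of one parallel weight `k ≥ 2` with one exponent `m` at every
`v ∣ p` is classically automorphic: an L-algebraic cuspidal `π` on `GL₂(𝔸_F)`, Satake–Frobenius
compatible with `ρ` a.e.  Hida control in degrees 1–2 + ordinary local–global compatibility for
completed cohomology + Eichler–Shimura–Harder (the parent's picked line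
`Cruxes/ProModularOrdinaryClassical/Lines/top_degree_exact_control.lean`).
[cite: Hida1993Duke] [cite: Hida1994AIF] [cite: SkinnerWiles1999, Prop. 3.7] -/
theorem stub_proModularOrdinaryClassical :
    Summit.Langlands.Langlands.Theses.SkinnerWilesDefectOne.ProModularOrdinaryClassical := by
  sorry

/-! ## 2. The stub statements by name (no text duplicated, no `sorry` inherited) -/

namespace _Goal

/-- The statement of `stub_integralTateFrame` (literally its type). [folklore] -/
def stub_integralTateFrame : Prop :=
  type_of% @Summit.Langlands.Langlands.Cruxes.UnorientedOrdinaryModular.Birth.stub_integralTateFrame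

/-- The statement of `stub_mixedProModular` (literally its type). [folklore] -/
def stub_mixedProModular : Prop :=
  type_of% @Summit.Langlands.Langlands.Cruxes.UnorientedOrdinaryModular.Birth.stub_mixedProModular

/-- The statement of `stub_nonDistinguishedProModular` (literally its type). [folklore] -/
def stub_nonDistinguishedProModular : Prop :=
  type_of% @Summit.Langlands.Langlands.Cruxes.UnorientedOrdinaryModular.Birth.stub_nonDistinguishedProModular

/-- The statement of `stub_proModularOrdinaryClassical` (literally its type). [folklore] -/
def stub_proModularOrdinaryClassical : Prop :=
  type_of% @Summit.Langlands.Langlands.Cruxes.UnorientedOrdinaryModular.Birth.stub_proModularOrdinaryClassical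

end _Goal

/-! ## 3. The composition (kernel-checked, sorry-free) -/

/-- **The crux from the four stubs** — `<stub₁-sig> → <stub₂-sig> → <stub₃-sig> → <stub₄-sig> →
UnorientedOrdinaryModular`, the hypotheses being the stub statements by name (`_Goal.stub_x`,
definitionally the signatures).  Pure logic plus two proved tree lemmas
(`PadicAlgCl.nonempty_ringEquiv_complex`, the rank-two Satake transport
`FiveIsogenyEllipticCurves.exists_hasSatakeParamAt_sum_prod_of_satakeFrobCompatibleAt`). [folklore] -/
theorem UnorientedOrdinaryModular_of (hD : _Goal.stub_integralTateFrame) (hM : _Goal.stub_mixedProModular)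
    (hN : _Goal.stub_nonDistinguishedProModular) (hX : _Goal.stub_proModularOrdinaryClassical) :
    UnorientedOrdinaryModular := by
  dsimp only [_Goal.stub_integralTateFrame, _Goal.stub_mixedProModular, _Goal.stub_nonDistinguishedProModular,
    _Goal.stub_proModularOrdinaryClassical] at hD hM hN hX
  intro F _ _ htc hdeg p _ hp E hΔ hcm hred hA hB hcpt
  -- stub 1: an integral, residually upper-triangular, commonly-ordinary irreducible Tate frame
  obtain ⟨O, ρ, ρ₀, hO, hTF, hmod, hord⟩ := hD F htc hdeg p hp E hΔ hcm hred hA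
  -- stubs 2 / 3: pro-modularity, by the `p`-distinguished dichotomy
  have h𝒰 : ∃ 𝒰 : Literature.NumberTheory.Automorphic.BigHeckeGLn.TameLevel 2 F p, 𝒰.IsPadicallyAutomorphic ρ := by
    by_cases hdist : ∀ v : IsDedekindDomain.HeightOneSpectrum (NumberField.RingOfIntegers F),
        (p : NumberField.RingOfIntegers F) ∈ v.asIdeal →
          Literature.NumberTheory.GaloisRepresentations.IsPDistinguishedAt ρ₀ v
    · exact hM F htc hdeg p hp E hΔ hcm hred hB O ρ ρ₀ hO hTF hmod hord hdist
    · have hnd : ∃ v : IsDedekindDomain.HeightOneSpectrum (NumberField.RingOfIntegers F),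
          (p : NumberField.RingOfIntegers F) ∈ v.asIdeal ∧
            ¬ Literature.NumberTheory.GaloisRepresentations.IsPDistinguishedAt ρ₀ v := by
        by_contra hcon
        exact hdist fun v hv => Classical.by_contradiction fun hnv => hcon ⟨v, hv, hnv⟩
      exact hN F htc hdeg p hp E hΔ hcm hred O ρ ρ₀ hO hTF hmod hord hnd
  -- stub 4: the exit, after choosing `ι : ℚ̄_p ≃+* ℂ`
  obtain ⟨ι⟩ := PadicAlgCl.nonempty_ringEquiv_complex p
  obtain ⟨hirr, hfrob⟩ := hTF
  have hunr : ∀ᶠ w : IsDedekindDomain.HeightOneSpectrum (NumberField.RingOfIntegers F) in Filter.cofinite,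
      ρ.IsUnramifiedAt w :=
    hfrob.mono fun w hw => hw.1
  obtain ⟨m, hm, hordv⟩ := hord
  obtain ⟨π, hLalg, hcompat⟩ := hX F htc hdeg p hp hcpt ι ρ hirr hunr h𝒰 ⟨2, le_rfl, m, hm, hordv⟩
  -- Satake transport: `SatakeFrobCompatibleAt` + charpoly `X² − a_w X + N w` ⇒ Σα⁻¹ = a_w, Πα⁻¹ = N w
  refine ⟨π, hLalg, ?_⟩
  filter_upwards [hcompat, hfrob] with w hw hw'
  exact Summit.Langlands.Langlands.Theorems.FiveIsogenyEllipticCurves.exists_hasSatakeParamAt_sum_prod_of_satakeFrobCompatibleAt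
    hw hw'.2

/-- **The crux BY NAME with the declared stubs plugged in** (the same composition; its only
non-whitelisted axiom is the stubs' `sorryAx`). [folklore] -/
theorem unorientedOrdinaryModular_of_stubs : UnorientedOrdinaryModular :=
  UnorientedOrdinaryModular_of stub_integralTateFrame stub_mixedProModular stub_nonDistinguishedProModular
    stub_proModularOrdinaryClassical

/-- Sanity (read-back): the conclusion of `UnorientedOrdinaryModular_of` is the route decl itself. [bookkeeping] -/
example : (_Goal.stub_integralTateFrame → _Goal.stub_mixedProModular → _Goal.stub_nonDistinguishedProModular →
    _Goal.stub_proModularOrdinaryClassical →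
      Summit.Langlands.Langlands.Theses.FifteenLocusEisenstein.UnorientedOrdinaryModular) :=
  UnorientedOrdinaryModular_of

end Summit.Langlands.Langlands.Cruxes.UnorientedOrdinaryModular.Birth

end
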